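import Summits.KontsevichZagierPeriods.KontsevichZagierPeriods.Theorems.SoloInformedAlgEdgeLocal
import Summits.KontsevichZagierPeriods.KontsevichZagierPeriods.Theorems.SoloInformedAlgStrip
import HarnessLib

/-!
# The DEN-calculus over `K`: denominators whose zeros lie on the coordinate cross

Solo programme `solo-KontsevichZagierPeriods-informed`, session s107, step (x-t) of the general
two-dimensional algorithm — **THEOREM B** `soloInformed_presentableDenK_of_crossZeros`: over a
real-root-closed field `K` of real algebraic numbers, a polynomial `P ∈ K[x₀, x₁]` with no zero
on the open square all of whose zeros on the closed square lie on the cross `{x₀ = 0} ∪ {x₁ = 0}`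
is a presentable denominator.

Proof: `P = x^m · R` (`m` the least exponent); `R` has finitely many zeros on the closed square,
all on the cross; by RULE LOCAL-GLOBAL it suffices to treat each zero `p` of `P`: where
`R(p) ≠ 0` case L1 applies, at `p = 0` the VERTEX package, at `p = (0, t)` the EDGE package (the
height `t` is a real root of the axis polynomial of `R`, hence in `K`), and at `p = (t, 0)` the
EDGE package after the swap `x₀ ↔ x₁` (`soloInformed_locallyPresentableDenK_of_swap`).

References: M. Kontsevich, D. Zagier, *Periods* (2001), §1.2; J. Kollár, *Lectures on Resolution
of Singularities* (2007), §1.8.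
-/

noncomputable section

open scoped BigOperators

namespace Summit.KontsevichZagierPeriods.KontsevichZagierPeriods.Theorems

variable {K : Type*} [Field K] [Algebra K ℝ]

/-! ### Transport of local presentability along the swap -/

/-- Swapping the coordinates of two points preserves their distance bound. [this work] -/
theorem soloInformed_dist_swap_lt {x p : Fin 2 → ℝ} {ε : ℝ} (hε : 0 < ε) (h : dist x p < ε) :
    dist (![x 1, x 0] : Fin 2 → ℝ) ![p 1, p 0] < ε := by
  rw [dist_pi_lt_iff hε] at h ⊢
  intro j
  fin_cases j
  · simpa using h 1
  · simpa using h 0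

/-- **Swap transport.**  Over a field `K` of real algebraic numbers: if `Q` has no zero on the
open square and `swap Q` is locally presentable at the swapped point, then `Q` is locally
presentable at `p` (the grid is swap-stable; RULE SWAP transports each cell). [this work] -/
theorem soloInformed_locallyPresentableDenK_of_swap
    (hK : ∀ c : K, IsAlgebraic ℚ (algebraMap K ℝ c)) {Q : MvPolynomial (Fin 2) K}
    (hQ : ∀ x ∈ soloInformedOpenCube 2, (MvPolynomial.aeval x Q : ℝ) ≠ 0) {p : Fin 2 → ℝ}
    (h : SoloInformedLocallyPresentableDenK (soloInformedSwapK Q) ![p 1, p 0]) :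
    SoloInformedLocallyPresentableDenK Q p := by
  obtain ⟨ε, hε, hH⟩ := h
  refine ⟨ε, hε, fun N c hN hc hcell => ?_⟩
  have hc' : ∀ j, (![c 1, c 0] : Fin 2 → ℕ) j < N := fun j => by
    fin_cases j
    · simpa using hc 1
    · simpa using hc 0
  have hball : ∀ x ∈ soloInformedCube 2,
      (fun j => (((![c 1, c 0] : Fin 2 → ℕ) j : ℝ) + x j) / N) ∈ Metric.ball ![p 1, p 0] ε := by
    intro x hx
    have h := soloInformed_dist_swap_lt hε (Metric.mem_ball.1 (hcell _ (soloInformed_swap_mem_cube hx)))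
    rw [Metric.mem_ball]
    convert h using 2
    funext j
    fin_cases j <;> simp
  have hB := hH N _ hN hc' hball
  refine soloInformed_presentableDenK_of_swap hK (fun x hx => ?_)
    (soloInformed_presentableDenK_congr (fun x _ => ?_) hB)
  · rw [soloInformed_aeval_gridSubstK]
    exact hQ _ (soloInformed_gridMoveR_mem_openCube _ hc hx)
  · rw [soloInformed_aeval_gridSubstK, soloInformed_gridMoveR_univ, soloInformed_aeval_swapK,
      soloInformed_aeval_swapK, soloInformed_aeval_gridSubstK, soloInformed_gridMoveR_univ]
    refine congrArg (fun v : Fin 2 → ℝ => (MvPolynomial.aeval v Q : ℝ)) ?_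
    funext j
    fin_cases j <;> simp

/-! ### Finitely many zeros are isolated -/

/-- A point has a neighbourhood meeting a finite set at most in the point itself. [this work] -/
theorem soloInformed_isolated_of_finite {Z : Set (Fin 2 → ℝ)} (hZ : Z.Finite) (p : Fin 2 → ℝ) :
    ∃ r > (0 : ℝ), ∀ y ∈ Z, dist y p < r → y = p := by
  obtain ⟨η, hη, -, hgap⟩ := soloInformed_exists_pos_lt_of_finite (hZ.image fun y => dist y p)
  refine ⟨η, hη, fun y hy hlt => ?_⟩
  by_contra hne
  exact lt_irrefl _ ((hgap _ ⟨y, hy, rfl⟩ (dist_pos.2 hne)).trans hlt)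

/-- A point of the plane with vanishing first coordinate is the axis point of its second
coordinate. [this work] -/
theorem soloInformed_eq_axisPoint_one {y : Fin 2 → ℝ} (h : y 0 = 0) :
    y = fun j => if j = (1 : Fin 2) then y 1 else 0 := by
  funext j
  fin_cases j <;> simp [h]

/-- A point of the plane with vanishing second coordinate is the axis point of its first
coordinate. [this work] -/
theorem soloInformed_eq_axisPoint_zero {y : Fin 2 → ℝ} (h : y 1 = 0) :
    y = fun j => if j = (0 : Fin 2) then y 0 else 0 := by
  funext j
  fin_cases j <;> simp [h]

/-! ### THEOREM B -/

omit [Algebra K ℝ] in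
/-- The swap of `x^m · R` is `x^{m ∘ swap} · swap R`. [this work] -/
theorem soloInformed_swapK_monomial_mul (m : Fin 2 →₀ ℕ) (u : K) (R : MvPolynomial (Fin 2) K) :
    soloInformedSwapK (MvPolynomial.monomial m u * R) =
      MvPolynomial.monomial (m.mapDomain (Equiv.swap (0 : Fin 2) 1)) u * soloInformedSwapK R := by
  unfold soloInformedSwapK
  rw [map_mul, MvPolynomial.rename_monomial]

/-- **THEOREM B.**  Over a real-root-closed field `K` of real algebraic numbers: a polynomial with
no zero on the open square whose zeros on the closed square lie on the cross
`{x₀ = 0} ∪ {x₁ = 0}` is a presentable denominator. [this work] -/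
theorem soloInformed_presentableDenK_of_crossZeros
    (hK : ∀ c : K, IsAlgebraic ℚ (algebraMap K ℝ c)) (hKrc : SoloInformedRealRootClosed K)
    {P : MvPolynomial (Fin 2) K}
    (hP : ∀ x ∈ soloInformedOpenCube 2, (MvPolynomial.aeval x P : ℝ) ≠ 0)
    (hZ : ∀ y ∈ soloInformedCube 2, (MvPolynomial.aeval y P : ℝ) = 0 → y 0 = 0 ∨ y 1 = 0) :
    SoloInformedPresentableDenK P := by
  have hP0 : P ≠ 0 := by
    intro h
    refine hP (fun _ => 1 / 2) (fun _ => ⟨by norm_num, by norm_num⟩) ?_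
    rw [h, map_zero]
  set m := soloInformedMinExpK P with hmdef
  set R := soloInformedStripK P m with hR
  have hm : ∀ e ∈ P.support, m ≤ e := fun e he => soloInformed_minExpK_le he
  have hPR : MvPolynomial.monomial m (1 : K) * R = P := soloInformed_monomial_mul_stripK P hm
  have hRZ : ∀ y : Fin 2 → ℝ, (MvPolynomial.aeval y R : ℝ) = 0 → (MvPolynomial.aeval y P : ℝ) = 0 :=
    fun y h => by rw [← hPR, map_mul, h, mul_zero]
  -- the zeros of `R` on the closed square: finitely many axis points
  have hfin : {y : Fin 2 → ℝ | y ∈ soloInformedCube 2 ∧ (MvPolynomial.aeval y R : ℝ) = 0}.Finite := by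
    have hA0 := (soloInformed_finite_axisZerosK 0 (soloInformed_edgePolyK_stripK_ne_zero hP0 0)).image
      fun t : ℝ => fun j : Fin 2 => if j = (0 : Fin 2) then t else 0
    have hA1 := (soloInformed_finite_axisZerosK 1 (soloInformed_edgePolyK_stripK_ne_zero hP0 1)).image
      fun t : ℝ => fun j : Fin 2 => if j = (1 : Fin 2) then t else 0
    refine (hA0.union hA1).subset ?_
    rintro y ⟨hy, hRy⟩
    rcases hZ y hy (hRZ y hRy) with h0 | h1
    · refine Or.inr ⟨y 1, ?_, (soloInformed_eq_axisPoint_one h0).symm⟩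
      rw [Set.mem_setOf_eq, ← soloInformed_eq_axisPoint_one h0]
      exact hRy
    · refine Or.inl ⟨y 0, ?_, (soloInformed_eq_axisPoint_zero h1).symm⟩
      rw [Set.mem_setOf_eq, ← soloInformed_eq_axisPoint_zero h1]
      exact hRy
  have hP' : ∀ x ∈ soloInformedOpenCube 2,
      (MvPolynomial.aeval x (MvPolynomial.monomial m (1 : K) * R) : ℝ) ≠ 0 := by
    rw [hPR]; exact hP
  rw [← hPR]
  refine soloInformed_presentableDenK_of_locally_at_zeros hK hP' fun p hp hp0 => ?_
  by_cases hRp : (MvPolynomial.aeval p R : ℝ) ≠ 0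
  · exact soloInformed_locallyPresentableDenK_monomial_mul hK m one_ne_zero R hRp
  push Not at hRp
  -- `p` is an isolated zero of `R` in the closed square
  obtain ⟨r, hr, hisoZ⟩ := soloInformed_isolated_of_finite hfin p
  have hiso : ∀ y ∈ soloInformedCube 2, dist y p < r → y ≠ p →
      (MvPolynomial.aeval y R : ℝ) ≠ 0 := fun y hy hd hne hy0 => hne (hisoZ y ⟨hy, hy0⟩ hd)
  -- the vertex `0`
  have hvertex : p = 0 →
      SoloInformedLocallyPresentableDenK (MvPolynomial.monomial m (1 : K) * R) p := fun hp00 => by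
    rw [hp00] at hiso ⊢
    exact soloInformed_locallyPresentableDenK_vertex hK hKrc m one_ne_zero hP' hr hiso
  -- heights of axis zeros are in `K`
  have hroot : ∀ (i : Fin 2) (t : ℝ),
      (MvPolynomial.aeval (fun j => if j = i then t else (0 : ℝ)) R : ℝ) = 0 →
      ∃ tK : K, algebraMap K ℝ tK = t := fun i t ht =>
    hKrc _ (soloInformed_edgePolyK_stripK_ne_zero hP0 i) t (by rw [soloInformed_aeval_edgePolyK]; exact ht)
  rcases hZ p hp (hRZ p hRp) with h0 | h1
  · -- `p = (0, t)`
    rcases (hp 1).1.eq_or_lt with h10 | h1pos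
    · exact hvertex (by funext j; fin_cases j; exacts [h0, h10.symm])
    have hpt : p = ![0, p 1] := by funext j; fin_cases j <;> simp [h0]
    have htK : ∃ tK : K, algebraMap K ℝ tK = p 1 :=
      hroot 1 (p 1) (by rw [← soloInformed_eq_axisPoint_one h0]; exact hRp)
    rw [hpt] at hiso ⊢
    exact soloInformed_locallyPresentableDenK_edge hK hKrc m one_ne_zero hP' h1pos htK hr hiso
  · -- `p = (t, 0)`: swap
    rcases (hp 0).1.eq_or_lt with h00 | h0pos
    · exact hvertex (by funext j; fin_cases j; exacts [h00.symm, h1])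
    have htK : ∃ tK : K, algebraMap K ℝ tK = p 0 :=
      hroot 0 (p 0) (by rw [← soloInformed_eq_axisPoint_zero h1]; exact hRp)
    refine soloInformed_locallyPresentableDenK_of_swap hK hP' ?_
    rw [h1, soloInformed_swapK_monomial_mul]
    refine soloInformed_locallyPresentableDenK_edge hK hKrc _ one_ne_zero (fun x hx => ?_) h0pos
      htK hr fun y hy hd hne => ?_
    · rw [← soloInformed_swapK_monomial_mul, soloInformed_aeval_swapK]
      exact hP' _ (soloInformed_swap_mem_openCube hx)
    · rw [soloInformed_aeval_swapK]
      refine hiso _ (soloInformed_swap_mem_cube hy) ?_ fun h => hne ?_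
      · have hd' := soloInformed_dist_swap_lt hr hd
        have hpp : (![(![0, p 0] : Fin 2 → ℝ) 1, (![0, p 0] : Fin 2 → ℝ) 0] : Fin 2 → ℝ) = p := by
          funext j; fin_cases j <;> simp [h1]
        rwa [hpp] at hd'
      · funext j
        fin_cases j
        · simpa [h1] using (congr_fun h 1).trans rfl
        · simpa using congr_fun h 0

end Summit.KontsevichZagierPeriods.KontsevichZagierPeriods.Theorems
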